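import Summits.ResolutionOfSingularities.ResolutionOfSingularities.Theorems.HilbertSamuelEliminationCampaignW42ConeRidgeDimPrime
import HarnessLib

/-!
# [OURS · L1 W4.2] Augmentations of local rings to a field, and the directrix dimension `e(·)_K` of the local rings of a cone at
# its vertex and at the rational points of its ridge, over an ARBITRARY field `K` (campaign s42, cell res-hironaka; informal crux
# `RidgeConfinement`, stmt-ResolutionOfSingularities-17845; `--supports`; brick D3a of the directrix form of CJS Thm. 3.10 (4))

HONEST FRAMING. OURS (slot W4.2, prover res-L1-s42-pv-1, gen 6). [OURS · L1 W4.2] replaces the role of nothing printed in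
H. Hironaka's manuscript. Bookkeeping for the directrix chain (`…CampaignW42ConeDirectrixPrime`): to carry an arbitrary field `K`
compatibly over all residue fields of a chain of local rings, each ring is AUGMENTED to a common field (`exists_ringHom_of_ker_eq`:
a localization `A_p` of `A` at the kernel of `g : A → F` maps to `F` killing `𝔪`; `lift_comp_map_of_comp_eq`: compatible
augmentations give compatible residue maps; `residueField_ringHom_ext`: maps out of `κ(A_p)` are determined on `A`). Then the
`e(·)_K` versions of the tree's vertex / translation lemmas (`…CampaignW42ConeVertexRidge`, gen 5, ridge form):
`dirDimOver_localization_vertex_eq_directrixDim` (`e(O_{C,0})_K = e(J · K[X])`), `exists_ringEquiv_localization_of_mem_ridge_algebraMap`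
(the translation `O_{C,v} ≅ O_{C,0}` commutes with `L`), `dirDimOver_localization_eq_directrixDim_of_mem_ridge` (`e(O_{C,v})_K = e(J · K[X])`
at an `L`-rational point of the ridge).

NOT a statement of H. Hironaka's manuscript [Hironaka2017]. AI review is weaker than expert review. References (orientation
only): B. Dietel, Dissertation Regensburg (2015), Satz (8.2.7) p. 105, (8.1.3), (8.2.3)–(8.2.6); V. Cossart, U. Jannsen, S. Saito,
LNM 2270 (2020), Thm. 3.10 (4), proof p. 46–50; J. Giraud, *Bull. Sci. Math.* 99 (1975) §1.5.
-/

noncomputable section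

-- single-conjunct summit: the doubled namespace component `ResolutionOfSingularities` is mandated
set_option linter.dupNamespace false
-- localizations of polynomial rings over quotient rings: nested instance problems (as in the gen-3/4/5 files)
set_option maxSynthPendingDepth 3

open IsLocalRing MvPolynomial Module
open Literature.RingTheory.HilbertSamuel
open Literature.RingTheory.MvPolynomial (idealDegree shift directrixDim)
open Literature.AlgebraicGeometry.Resolution

namespace Summit.ResolutionOfSingularities.ResolutionOfSingularities.Theorems

namespace CampaignW42

universe u

/-! ## Augmentations of local rings to a field, and the field `K` over the residue fields -/

section Augment

/-- A ring homomorphism from a local ring to a field killing the maximal ideal is local. [folklore] -/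
theorem isLocalHom_of_forall_mem_maximalIdeal {R F : Type*} [CommRing R] [IsLocalRing R] [Field F] (ρ : R →+* F)
    (h : ∀ x ∈ maximalIdeal R, ρ x = 0) : IsLocalHom ρ := by
  refine ⟨fun a ha => ?_⟩
  by_contra hna
  exact ha.ne_zero (h a ((IsLocalRing.mem_maximalIdeal a).mpr hna))

/-- **Augmentation of a localization at a kernel**: for `g : A → F` into a field with prime kernel `p` and a localization `Lo`
of `A` at `p`, `g` extends to `ρ : Lo → F` killing `𝔪_{Lo}`. [folklore] -/
theorem exists_ringHom_of_ker_eq {A : Type*} [CommRing A] {F : Type*} [Field F] (g : A →+* F) (p : Ideal A) [p.IsPrime]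
    (hp : RingHom.ker g = p) (Lo : Type*) [CommRing Lo] [Algebra A Lo] [IsLocalization.AtPrime Lo p] [IsLocalRing Lo] :
    ∃ ρ : Lo →+* F, ρ.comp (algebraMap A Lo) = g ∧ ∀ x ∈ maximalIdeal Lo, ρ x = 0 := by
  have hunit : ∀ y : p.primeCompl, IsUnit (g y) := fun y => by
    refine isUnit_iff_ne_zero.mpr fun h0 => y.2 ?_
    have h1 : (y : A) ∈ RingHom.ker g := h0
    rw [hp] at h1
    exact h1
  refine ⟨IsLocalization.lift hunit, IsLocalization.lift_comp hunit, fun x hx => ?_⟩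
  rw [← IsLocalization.AtPrime.map_eq_maximalIdeal p Lo] at hx
  have hle : p.map (algebraMap A Lo) ≤ RingHom.ker (IsLocalization.lift hunit : Lo →+* F) := by
    rw [Ideal.map_le_iff_le_comap]
    intro y hy
    rw [Ideal.mem_comap, RingHom.mem_ker, IsLocalization.lift_eq]
    have h1 : y ∈ RingHom.ker g := by rw [hp]; exact hy
    exact h1
  exact hle hx

/-- Compatible augmentations give compatible maps of residue fields: `ρ₂ ∘ f = ρ₁ ⟹ lift ρ₂ ∘ κ(f) = lift ρ₁`. [folklore] -/
theorem lift_comp_map_of_comp_eq {R₁ R₂ F : Type*} [CommRing R₁] [CommRing R₂] [IsLocalRing R₁] [IsLocalRing R₂] [Field F]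
    (f : R₁ →+* R₂) [IsLocalHom f] (ρ₁ : R₁ →+* F) (ρ₂ : R₂ →+* F) [IsLocalHom ρ₁] [IsLocalHom ρ₂]
    (h : ρ₂.comp f = ρ₁) : (ResidueField.lift ρ₂).comp (ResidueField.map f) = ResidueField.lift ρ₁ := by
  refine RingHom.ext fun x => ?_
  obtain ⟨a, rfl⟩ := residue_surjective x
  rw [RingHom.comp_apply, ResidueField.map_residue, ResidueField.lift_residue_apply, ResidueField.lift_residue_apply,
    ← RingHom.comp_apply, h]

/-- Two homomorphisms out of the residue field of a localization `Lo = A_p` into a field that agree on the residues of `A`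
are equal (`κ(Lo) = Frac(A/p)`). [folklore] -/
theorem residueField_ringHom_ext {A : Type*} [CommRing A] (p : Ideal A) [p.IsPrime] (Lo : Type*) [CommRing Lo] [Algebra A Lo]
    [IsLocalization.AtPrime Lo p] [IsLocalRing Lo] {F : Type*} [Field F] {f g : ResidueField Lo →+* F}
    (h : ∀ a : A, f (residue Lo (algebraMap A Lo a)) = g (residue Lo (algebraMap A Lo a))) : f = g := by
  refine RingHom.ext fun x => ?_
  obtain ⟨y, rfl⟩ := residue_surjective x
  obtain ⟨⟨a, s⟩, hy⟩ := IsLocalization.mk'_surjective p.primeCompl y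
  rw [← hy]
  have hs : IsUnit (algebraMap A Lo s) := IsLocalization.map_units Lo s
  have hs' : residue Lo (algebraMap A Lo (s : A)) ≠ 0 := (hs.map (residue Lo)).ne_zero
  have key : residue Lo (IsLocalization.mk' Lo a s) =
      residue Lo (algebraMap A Lo a) * (residue Lo (algebraMap A Lo (s : A)))⁻¹ := by
    rw [eq_mul_inv_iff_mul_eq₀ hs', ← map_mul, IsLocalization.mk'_spec]
  rw [key, map_mul, map_mul, map_inv₀, map_inv₀, h a, h s]

end Augment

/-! ## The vertex and the rational points of the ridge, for `e(·)_K` -/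

section Vertex

variable {L : Type u} [Field L] {n : ℕ} {J : Ideal (MvPolynomial (Fin n) L)} (hJ : IsHomogeneousIdeal J)

include hJ in
/-- **`e(O_{C,0})_K = e(C)_K = e(J · K[X])`** for the local ring of the cone `C = V(J)` at its vertex (`J` homogeneous without
linear forms) and every field `K` over `L` and `κ(O_{C,0}) (= L)` compatibly: the tangent cone of `O_{C,0}` is `C`
(`tangentConeIdeal_vertex_eq_map`). [cite: Dietel2015, (8.1.3)] [cite: CossartJannsenSaito2020, Def. 2.18, §2.2] -/
theorem dirDimOver_localization_vertex_eq_directrixDim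
    [((RingHom.ker (eval (0 : Fin n → L))).map (Ideal.Quotient.mk J)).IsMaximal]
    (L₀ : Type u) [CommRing L₀] [Algebra (MvPolynomial (Fin n) L ⧸ J) L₀] [Algebra L L₀]
    [IsScalarTower L (MvPolynomial (Fin n) L ⧸ J) L₀]
    [IsLocalization.AtPrime L₀ ((RingHom.ker (eval (0 : Fin n → L))).map (Ideal.Quotient.mk J))]
    [IsLocalRing L₀] [IsNoetherianRing L₀] (hJ1 : finrank L (idealDegree J 1) = 0)
    (K : Type u) [Field K] [Algebra (ResidueField L₀) K] [Algebra L K]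
    (hc : (algebraMap (ResidueField L₀) K).comp (algebraMap L (ResidueField L₀)) = algebraMap L K) :
    dirDimOver L₀ K = directrixDim (J.map (MvPolynomial.map (algebraMap L K))) := by
  classical
  have he := spanFinrank_maximalIdeal_vertex_eq hJ L₀ hJ1
  rw [dirDimOver_eq' L₀ K he _ (span_range_vertexPoint_eq_maximalIdeal (J := J) L₀), tangentConeIdeal_vertex_eq_map hJ L₀,
    Ideal.map_map]
  congr 2
  refine RingHom.ext fun p => ?_
  rw [RingHom.comp_apply, MvPolynomial.map_map, hc]

include hJ in
/-- **`O_{C,v} ≅ O_{C,0}` over `L`** for an `L`-rational point `v` of the ridge: the translation isomorphism of the tree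
(`nonempty_ringEquiv_localization_of_mem_ridge`) commutes with the structure maps from `L`. [cite: Giraud1975, §1.5]
[cite: Dietel2015, (8.1.3)] -/
theorem exists_ringEquiv_localization_of_mem_ridge_algebraMap {v : Fin n → L} (hv : v ∈ ridge L J)
    (hJv : J ≤ RingHom.ker (eval v))
    [((RingHom.ker (eval v)).map (Ideal.Quotient.mk J)).IsPrime]
    [((RingHom.ker (eval (0 : Fin n → L))).map (Ideal.Quotient.mk J)).IsPrime]
    (Lv : Type u) [CommRing Lv] [Algebra (MvPolynomial (Fin n) L ⧸ J) Lv]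
    [IsLocalization.AtPrime Lv ((RingHom.ker (eval v)).map (Ideal.Quotient.mk J))]
    (L₀ : Type u) [CommRing L₀] [Algebra (MvPolynomial (Fin n) L ⧸ J) L₀]
    [IsLocalization.AtPrime L₀ ((RingHom.ker (eval (0 : Fin n → L))).map (Ideal.Quotient.mk J))] :
    ∃ e : Lv ≃+* L₀, ∀ c : L, e (algebraMap (MvPolynomial (Fin n) L ⧸ J) Lv (Ideal.Quotient.mk J (C c))) =
      algebraMap (MvPolynomial (Fin n) L ⧸ J) L₀ (Ideal.Quotient.mk J (C c)) := by
  have hJJ : J = J.map ((shiftEquiv v).toRingEquiv : MvPolynomial (Fin n) L →+* MvPolynomial (Fin n) L) := by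
    conv_lhs => rw [← map_shift_eq_of_mem_ridge hJ hv]
    rfl
  set e := Ideal.quotientEquiv J J (shiftEquiv v).toRingEquiv hJJ
  have hQ := map_ker_eval_eq_comap_quotientEquiv hJ hv hJv hJJ
  have hM : Submonoid.map e.toMonoidHom ((RingHom.ker (eval v)).map (Ideal.Quotient.mk J)).primeCompl =
      ((RingHom.ker (eval (0 : Fin n → L))).map (Ideal.Quotient.mk J)).primeCompl := by
    ext x
    rw [Submonoid.mem_map]
    constructor
    · rintro ⟨y, hy, rfl⟩ hx
      refine hy ?_
      rw [hQ]
      exact hx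
    · intro hx
      refine ⟨e.symm x, fun h' => hx ?_, e.apply_symm_apply x⟩
      have h'' : e.symm x ∈ (RingHom.ker (eval v)).map (Ideal.Quotient.mk J) := h'
      rw [hQ, Ideal.mem_comap] at h''
      change e (e.symm x) ∈ _ at h''
      rw [e.apply_symm_apply] at h''
      exact h''
  refine ⟨IsLocalization.ringEquivOfRingEquiv Lv L₀ e hM, fun c => ?_⟩
  rw [IsLocalization.ringEquivOfRingEquiv_eq]
  congr 1
  change e (Ideal.Quotient.mk J (C c)) = Ideal.Quotient.mk J (C c)
  have h1 : e (Ideal.Quotient.mk J (C c)) = Ideal.Quotient.mk J ((shiftEquiv v).toRingEquiv (C c)) := rfl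
  rw [h1]
  congr 1
  change shiftEquiv v (C c) = C c
  rw [shiftEquiv_apply, shift, aeval_C, MvPolynomial.algebraMap_eq]

include hJ in
/-- **`e(O_{C,v})_K = e(C)_K`** at an `L`-rational point `v ∈ C(L)` of the ridge of the cone of a homogeneous ideal without
linear forms, for every field `K` over `L` and `κ(O_{C,v})` compatibly. [cite: Dietel2015, (8.1.3)] [cite: Giraud1975, §1.5] -/
theorem dirDimOver_localization_eq_directrixDim_of_mem_ridge {v : Fin n → L} (hv : v ∈ ridge L J)
    (hJv : J ≤ RingHom.ker (eval v)) (hJ1 : finrank L (idealDegree J 1) = 0)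
    [((RingHom.ker (eval v)).map (Ideal.Quotient.mk J)).IsPrime]
    (Lv : Type u) [CommRing Lv] [Algebra (MvPolynomial (Fin n) L ⧸ J) Lv] [Algebra L Lv]
    [IsScalarTower L (MvPolynomial (Fin n) L ⧸ J) Lv]
    [IsLocalization.AtPrime Lv ((RingHom.ker (eval v)).map (Ideal.Quotient.mk J))] [IsLocalRing Lv] [IsNoetherianRing Lv]
    (K : Type u) [Field K] [Algebra (ResidueField Lv) K] [Algebra L K]
    (hc : (algebraMap (ResidueField Lv) K).comp (algebraMap L (ResidueField Lv)) = algebraMap L K) :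
    dirDimOver Lv K = directrixDim (J.map (MvPolynomial.map (algebraMap L K))) := by
  classical
  haveI := isMaximal_map_ker_eval (le_ker_eval_zero_of_mem_ridge hJ hv hJv)
  haveI : IsNoetherianRing (MvPolynomial (Fin n) L ⧸ J) := inferInstance
  let L₀ := Localization.AtPrime ((RingHom.ker (eval (0 : Fin n → L))).map (Ideal.Quotient.mk J))
  obtain ⟨e, he⟩ := exists_ringEquiv_localization_of_mem_ridge_algebraMap hJ hv hJv Lv L₀
  -- the field `K` over `κ(L₀)`, through `e⁻¹`
  letI algK0 : Algebra (ResidueField L₀) K :=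
    ((algebraMap (ResidueField Lv) K).comp (ResidueField.map (e.symm : L₀ →+* Lv))).toAlgebra
  have hK : (algebraMap (ResidueField L₀) K).comp (ResidueField.map (e : Lv →+* L₀)) = algebraMap (ResidueField Lv) K := by
    refine RingHom.ext fun x => ?_
    obtain ⟨a, rfl⟩ := residue_surjective x
    change ((algebraMap (ResidueField Lv) K).comp (ResidueField.map (e.symm : L₀ →+* Lv)))
      (ResidueField.map (e : Lv →+* L₀) (residue Lv a)) = _
    rw [ResidueField.map_residue, RingHom.comp_apply, ResidueField.map_residue]
    change algebraMap (ResidueField Lv) K (residue Lv (e.symm (e a))) = _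
    rw [e.symm_apply_apply]
  have hc0 : (algebraMap (ResidueField L₀) K).comp (algebraMap L (ResidueField L₀)) = algebraMap L K := by
    rw [← hc]
    refine RingHom.ext fun c => ?_
    change ((algebraMap (ResidueField Lv) K).comp (ResidueField.map (e.symm : L₀ →+* Lv))) (algebraMap L (ResidueField L₀) c) =
      (algebraMap (ResidueField Lv) K) (algebraMap L (ResidueField Lv) c)
    rw [RingHom.comp_apply]
    congr 1
    rw [IsScalarTower.algebraMap_apply L L₀ (ResidueField L₀), IsScalarTower.algebraMap_apply L Lv (ResidueField Lv)]
    change ResidueField.map _ (residue L₀ _) = residue Lv _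
    rw [ResidueField.map_residue]
    congr 1
    change e.symm (algebraMap L L₀ c) = algebraMap L Lv c
    rw [RingEquiv.symm_apply_eq, IsScalarTower.algebraMap_apply L (MvPolynomial (Fin n) L ⧸ J) Lv,
      IsScalarTower.algebraMap_apply L (MvPolynomial (Fin n) L) (MvPolynomial (Fin n) L ⧸ J), Ideal.Quotient.algebraMap_eq,
      MvPolynomial.algebraMap_eq, he c, IsScalarTower.algebraMap_apply L (MvPolynomial (Fin n) L ⧸ J) L₀,
      IsScalarTower.algebraMap_apply L (MvPolynomial (Fin n) L) (MvPolynomial (Fin n) L ⧸ J), Ideal.Quotient.algebraMap_eq,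
      MvPolynomial.algebraMap_eq]
  rw [← dirDimOver_eq_of_ringEquiv e K hK]
  exact dirDimOver_localization_vertex_eq_directrixDim hJ L₀ hJ1 K hc0

end Vertex

end CampaignW42

end Summit.ResolutionOfSingularities.ResolutionOfSingularities.Theorems

end
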